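import Summits.QuantumFields.BalabanUV.T4Continuum.Support.NE7StabiliserLiftingUniformOfNearFlat
import Summits.QuantumFields.BalabanUV.T4Continuum.Support.NE7SymmetricFlatNearOfACU
import Summits.QuantumFields.BalabanUV.T4Continuum.Support.NE7AlmostCommutingUnitaries
import HarnessLib

/-!
# NE7StabiliserLiftingUniform — THE STABILISER LIFTING OF ✓ `NE7StabiliserLifting.stabiliser_lifting` (p824904) WITH THE QUANTIFIERS `∃ δ_V ∀ k`
# (ROAD-G115 §5 (iv) «j-uniform δ_V for the lifting (ask NE7b)»): UNCONDITIONAL, every `U(n)`, every `L ≥ 2`, every level `k`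

Cell `pub-balaban`, rung (B)+1 sub-cell t4, lineage `b2b-balaban-t4-ne7b-p1` (row NE7b OWNER + CRUX PROVER; junction service for row NE7, ruling R-OWNER-149-1 (2)),
generation 159.  Memo `t4/b2b-balaban-t4-ne7b-p1/g159/records/SCOPING-uniform-lifting.md`; index `t4/b2b-balaban-t4-ne7b-p1/g159/INDEX.md`.
THE ASSEMBLY (the SYMMETRIC CONTINUITY METHOD, all letters landed this generation).  ✓ `NE7StabiliserLiftingUniformOfNearFlat.stabiliser_lifting_uniform_of_nearFlat`:
the lifting with `∃ ε′ ∀ k` over every datum admitting an `ε′`-close FLAT datum with at least its symmetry (continuity method inside the fixed set of the stabiliser: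
✓ `…UniformEnd`, ✓ `NE7SymmetricFibreLHC`, ✓ `NE7SymmetricOpenOfMinimisation`, ✓ `…UniformOfPath`, symmetric chord ✓ `…UniformOfNearFlat`);
✓ `NE7SymmetricFlatNearOfACU.exists_symmetric_flat_near_of_ACU`: such a flat symmetric datum exists `γ`-close to every `γ`-small datum GIVEN the matrix lemma (ACU)
(loop coordinates ✓ `NE7CombLoopReconstruction`, ✓ `NE7FlatLoopCommute`, compactness); ✓ `NE7AlmostCommutingUnitaries.acu_curried`: (ACU) (one self-adjoint generator
✓ `NE7CommutingUnitariesResolution` ∕ `NE7SingleGenerator` ∕ `NE7SpectralResolution`, cluster projections ✓ `NE7SpectralClusterProjections`).  Level `0` is trivial (`U = V₀`, lift `s`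
itself), levels `k + 1` are the theorem of ✓ `…UniformOfNearFlat`.
WHAT ([folklore]; 0 def, 0 sorry).  §1 **`exists_symmetric_flat_near`** (generic `d`, `N ≥ 1`): `∀ ε′>0 ∃ γ>0`: every unitary `N`-periodic `γ`-small `V` admits a unitary
`N`-periodic FLAT `F` with `‖F(b)⁻¹V(b) − 1‖ ≤ ε′` and `F^s = F` whenever `V^s = V` (`s` unitary `N`-periodic).  §2 **`stabiliser_lifting_uniform`** (`d = 4`): LITERALLY the
statement of ✓ `NE7StabiliserLifting.stabiliser_lifting` with `∀ k ∃ δV` replaced by `∃ δV ∀ k` — `∃ ε₀ ∀ 0<ε≤ε₀ ∀ N≥1 ∃ δ_V>0 ∀ k ∀ V₀` (unitary, `N`-periodic, `δ_V`-small)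
`∀ U` minimiser of `sfClass 4 L N ε` at level `k` over `V₀` `∀ s ∈ Stab(V₀)` (unitary, `N`-periodic): `∃ h` unitary `(N·L^k)`-periodic with `U^h = U` and `h(L^k•z) = s(z)`.
CONSEQUENCE FOR THE ROAD (t4-ne7-p1, not done here): re-running the ten-line assembly of ✓ `NE7MinimiserC1AllData` with this theorem gives its `δ_V` uniformly in `j`.
HONEST FRAMING (page 1): composition of kernel theorems of ours about OUR minimisers of OUR small-field class on the finite lattice; nothing of Bałaban's is asserted;
NOT NE7 as a spine node, NOT NE3; row NE7b NOT PRINTED ∕ NOT PROVED; spine 0∕9; finite T⁴ rung (B)+1 — NOT infinite volume, NOT mass gap, NOT BetaPertH, NOT Clay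
(continuum YM on T⁴ ⇐ BetaPertH ∧ nine spine estimates).
-/

set_option autoImplicit false

open scoped BigOperators Matrix Matrix.Norms.L2Operator Topology

namespace Summit.QuantumFields.BalabanUV.T4Continuum.NE7StabiliserLiftingUniform

open Literature.MathematicalPhysics.QuantumFieldTheory.Balaban1983to89
open B7Prop1Explicit B7Prop2Explicit
open T4AveragingDeficitWall (IsUnitaryCfg SmallField)
open T4AveragingDeficitWallBoundary (IsPeriodicCfg)
open MinimalActionSandwich (IsMinimiser)
open MinimalActionRate (sfClass)
open NE3EnergyShapes (IsUnitarySite IsPeriodicSite)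
open NE7StabiliserLiftingUniformOfNearFlat (stabiliser_lifting_uniform_of_nearFlat)
open NE7SymmetricFlatNearOfACU (exists_symmetric_flat_near_of_ACU)
open NE7AlmostCommutingUnitaries (acu_curried)

noncomputable section

variable {d : ℕ} {n : Type} [Fintype n] [DecidableEq n]

/-! ## §1 (NEAR-FLAT_K), unconditional -/

/-- **NEAR A SMALL DATUM THERE IS A FLAT DATUM AT LEAST AS SYMMETRIC** (generic `d`): for every `ε′ > 0` there is `γ > 0` such that every unitary `N`-periodic `γ`-small
`V` admits a unitary `N`-periodic flat `F` with `‖F(b)⁻¹V(b) − 1‖ ≤ ε′` on every bond and `F^s = F` for every unitary `N`-periodic `s` with `V^s = V`. [folklore] -/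
theorem exists_symmetric_flat_near [Nonempty n] {N : ℕ} [NeZero N] {ε' : ℝ} (hε' : 0 < ε') :
    ∃ γ : ℝ, 0 < γ ∧ ∀ V : Site d → Fin d → (Matrix n n ℂ)ˣ, IsUnitaryCfg V → IsPeriodicCfg V (N : ℤ) → SmallField V γ →
      ∃ F : Site d → Fin d → (Matrix n n ℂ)ˣ, IsUnitaryCfg F ∧ IsPeriodicCfg F (N : ℤ) ∧ SmallField F 0 ∧
        (∀ (x : Site d) (κ : Fin d), ‖(((F x κ)⁻¹ : (Matrix n n ℂ)ˣ) : Matrix n n ℂ) * (V x κ : Matrix n n ℂ) - 1‖ ≤ ε') ∧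
        ∀ s : Site d → (Matrix n n ℂ)ˣ, IsUnitarySite s → IsPeriodicSite s (N : ℤ) → gaugeAct s V = V → gaugeAct s F = F :=
  exists_symmetric_flat_near_of_ACU (d := d) (N := N) (acu_curried (n := n)) hε'

/-! ## §2 The stabiliser lifting with `∃ δ_V ∀ k` -/

/-- **STABILISER LIFTING, UNIFORMLY IN THE LEVEL** (`d = 4`, every `U(n)`, `L ≥ 2`): there is `ε₀ > 0` such that for `0 < ε ≤ ε₀` and `N ≥ 1` there is ONE `δ_V > 0`
serving EVERY level `k`: for every unitary `N`-periodic `δ_V`-small datum `V₀`, every minimiser `U` of `sfClass 4 L N ε` at level `k` over `V₀` and every unitary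
`N`-periodic `s` with `V₀^s = V₀` there is a unitary `(N·L^k)`-periodic `h` with `U^h = U` and corner values `h(L^k•z) = s(z)` — the statement of
✓ `NE7StabiliserLifting.stabiliser_lifting` with the quantifiers `∃ δ_V ∀ k` (ROAD-G115 §5 (iv)). [folklore] -/
theorem stabiliser_lifting_uniform [Nonempty n] {L : ℕ} (hL : 2 ≤ L) :
    ∃ ε₀ : ℝ, 0 < ε₀ ∧ ∀ ε : ℝ, 0 < ε → ε ≤ ε₀ → ∀ (N : ℕ) [NeZero N], 1 ≤ N → ∃ δV : ℝ, 0 < δV ∧ ∀ k : ℕ,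
      ∀ V₀ ∈ {V : Site 4 → Fin 4 → (Matrix n n ℂ)ˣ | IsUnitaryCfg V ∧ IsPeriodicCfg V (N : ℤ) ∧ SmallField V δV},
      ∀ U : Site 4 → Fin 4 → (Matrix n n ℂ)ˣ, IsMinimiser 4 (sfClass 4 L N ε) L N k V₀ U →
      ∀ s : Site 4 → (Matrix n n ℂ)ˣ, IsUnitarySite s → IsPeriodicSite s (N : ℤ) → gaugeAct s V₀ = V₀ →
        ∃ h : Site 4 → (Matrix n n ℂ)ˣ, IsUnitarySite h ∧ IsPeriodicSite h ((N * L ^ k : ℕ) : ℤ) ∧ gaugeAct h U = U ∧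
          ∀ z : Site 4, h (((L : ℤ) ^ k) • z) = s z := by
  obtain ⟨ε₀, hε₀, H⟩ := stabiliser_lifting_uniform_of_nearFlat (n := n) hL
  refine ⟨ε₀, hε₀, fun ε hε hεle N _ hN => ?_⟩
  obtain ⟨ε', hε', H1⟩ := H ε hε hεle N hN
  obtain ⟨γ, hγ, hnear⟩ := exists_symmetric_flat_near (d := 4) (n := n) (N := N) hε'
  refine ⟨γ, hγ, fun k V₀ hV₀ U hU s hsu hsP hsfix => ?_⟩
  obtain ⟨hV₀u, hV₀P, hV₀δ⟩ := hV₀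
  cases k with
  | zero =>
      -- level `0`: `U = V₀`, the lift is `s` itself
      have hU0 : U = V₀ := hU.mem.2
      have hcast : ((N * L ^ 0 : ℕ) : ℤ) = (N : ℤ) := by simp
      refine ⟨s, hsu, ?_, ?_, fun z => ?_⟩
      · rw [hcast]; exact hsP
      · rw [hU0]; exact hsfix
      · rw [pow_zero, one_smul]
  | succ j =>
      exact H1 j V₀ hV₀u hV₀P (hnear V₀ hV₀u hV₀P hV₀δ) U hU s hsu hsP hsfix

end

end Summit.QuantumFields.BalabanUV.T4Continuum.NE7StabiliserLiftingUniform
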